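import Summits.Ventures.HSemireg.Mod4CarrierMiddleDegree
import Summits.Ventures.HSemireg.WedgeWeilPurityNoLocus
import Summits.Ventures.HSemireg.WedgeWeilCarrierRank

/-!
# Venture HSemireg — MOD-4 line: the PURE WEIL CLASS `a·w₊ + b·w₋` ON THE p4 CARRIER (`R_k = 2·C(2n,k)` for `1 ≤ k ≤ n`)

HONEST FRAMING. Part of the Lean index of the computation cell `pub-hsemireg` (widening group W3, seat w3-mod4-1 gen 6; file of
record `HOME/widen/W3/MOD4-OFFSPLIT-w3mod4.md` (E4) / row T1-9a / §12).  Finite-dimensional exterior algebra over a field ONLY (p4's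
carrier of Weil type `(n,n)`, th-7's wedge model): no abelian variety, no sheaf, no Ext group, no semiregularity map; nothing here says
that HC, HC_CM or HC_AV holds; no Literature fact is declared or used.  WHAT IS PROVED (proof-only): for the pure Weil class
`w = a·wUp + b·wLow` (`a, b ≠ 0`, no h-part) on p4's carrier: **`dim S_k(w) = 2·C(2n,k)`** for the side degrees `1 ≤ k ≤ n − 1`
(`finrank_S_pureWeil_nn_deg`; p4's `WeilCarrier.finrank_S_weil_nn_deg` at `q = 0`, Hankel rank `0`) and for the middle degree `k = n`,
`n ≥ 1` (`finrank_S_pureWeil_nn_middle`; th-7's `weil_pureWeil_vW` carried by seat g6's exact transport `finrank_S_eq_model_nn`) — the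
«pure W» row `2C(2n,k)` of MOD4-OFFSPLIT's TABLE R (sixfold `(1,12,30,40,30,12,1)`), whose Euler pin `R(−1) = −2 < 0` against
Hodge–Riemann is THEOREM (E4)'s exclusion of pure Weil Mukai vectors (the pin itself is not restated here).
All statements and proofs: w3-mod4-1 g6 (2026-08-23).  Namespace `Summit.Ventures.HSemireg.Mod4Carrier`.
References: [BuchweitzFlenner2008HH] Prop. 6.4.4 (why these operators); [BourbakiAlgebre1a3] Ch. III §11 no. 9.
-/

open Module

namespace Summit.Ventures.HSemireg.Mod4Carrier

open Summit.Ventures.HSemireg.WedgeBridge Summit.Ventures.HSemireg.WeilCarrier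
open Summit.Ventures.HSemireg.Wedge.Hankel Summit.Ventures.HSemireg.Wedge.WeilPurity

variable {K : Type*} [Field K] {n : ℕ} {V : Type*} [AddCommGroup V] [Module K V] (bV : Basis (Fin ((n + n) + (n + n))) K V)

/-- the Hankel matrices of the zero sequence vanish. -/
lemma hankel1_zero_seq (N k : ℕ) : hankel1 K N k (fun _ => (0 : K)) = 0 := by
  ext i s; rfl

/-- **PURE WEIL CLASS ON THE CARRIER, middle degree:** `dim S_n(a·w₊ + b·w₋) = 2·C(2n,n)` (`n ≥ 1`, `a, b ≠ 0`).
[cite: BuchweitzFlenner2008HH, Prop. 6.4.4] -/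
theorem finrank_S_pureWeil_nn_middle (hn : 0 < n) {a b : K} (ha : a ≠ 0) (hb : b ≠ 0) :
    Module.finrank K (S K (Lsp bV) n (a • wUp bV n + b • wLow bV n)) = 2 * (n + n).choose n := by
  have ha' : (-1 : K) ^ (n * n) * a ≠ 0 := mul_ne_zero (pow_ne_zero _ (neg_ne_zero.mpr one_ne_zero)) ha
  have h := finrank_S_eq_model_nn bV (fun _ => (0 : K)) a b n
  rw [Ecl_zero_seq, zero_add] at h
  rw [h]
  exact weil_pureWeil_vW K hn ha' hb

/-- **PURE WEIL CLASS ON THE CARRIER, side degrees:** `dim S_k(a·w₊ + b·w₋) = 2·C(2n,k)` (`1 ≤ k ≤ n − 1`, `a, b ≠ 0`).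
[cite: BuchweitzFlenner2008HH, Prop. 6.4.4] -/
theorem finrank_S_pureWeil_nn_deg {k : ℕ} (hk1 : 1 ≤ k) (hkn : k + 1 ≤ n) {a b : K} (ha : a ≠ 0) (hb : b ≠ 0) :
    Module.finrank K (S K (Lsp bV) k (a • wUp bV n + b • wLow bV n)) = 2 * (n + n).choose k := by
  have h := finrank_S_weil_nn_deg bV hk1 hkn (fun _ => (0 : K)) ha hb
  rw [Ecl_zero_seq, zero_add, hankel1_zero_seq, Matrix.rank_zero, mul_zero, mul_zero, add_zero, add_zero] at h
  omega

end Summit.Ventures.HSemireg.Mod4Carrier
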